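import Summits.BirchSwinnertonDyer.BirchSwinnertonDyer.Theorems.GenusKolyvaginAtTwoPowDvdShaCardAtTwoRTRankDescentRankLeOne
import Summits.BirchSwinnertonDyer.BirchSwinnertonDyer.Theorems.GenusKolyvaginAtTwoCasselsTateNumberField
import Literature.NumberTheory.EllipticCurves.CasselsTateLevelPrimary
import Literature.NumberTheory.EllipticCurves.CasselsTateGeneralCaseKernel
import Literature.NumberTheory.EllipticCurves.ShaFiniteProofs
import HarnessLib

/-!
# Route `GenusKolyvaginAtTwo`, crux U_T `ShaCardDvdPowAtTwoRT` (stmt-BirchSwinnertonDyer-23658) —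
# **`Ш(E/K)[2^∞]` IS FINITE AND KILLED BY `2^(M₀+2)` ON U_T's FRAME** (Kolyvagin's Theorem A, Ш-half, AT `2`, from Q2 + the tree)

Seat `bsd-line-gk2-p5` g29 (WIDTH-5 attach, cell `bsd-f1-sign2`), `--supports stmt-BirchSwinnertonDyer-23658` (helper; closes nothing).
THEOREMS ONLY (no definition, no named fact, no `sorry`).  BSD is NOT proved by any of this; neither is U_T.

WHY.  U_T concludes `Nat.card Ш(E/K)[2^∞] ∣ 2^(2M₀)`; since `Nat.card` of an infinite type is `0`, this silently contains the
FINITENESS of `Ш(E/K)[2^∞]`.  Every Cassels–Tate certificate argument for U_T (McCallum 1991 Thm. 5.4, the U_T memo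
`Cruxes/ShaCardDvdPowAtTwoRT/Lines/norm-sharp-upper-gk2p3.md` §1/§5) needs the level pairing on ALL of `Ш(E/K)[2^∞]`, i.e. the
hypothesis `hk : 2^k • Ш(E/K)[2^∞] = 0` of the tree's `exists_primaryComponent_ctLevelPairing` / `exists_selmerToPrimaryComponent` /
`sha_hL_of_pow_kills`; on L_T's side the closers go `by_cases Finite …`.  This file discharges that hypothesis AT `2` on U_T's exact
frame, with NO print bundle: only Q2 (`KolyvaginRelationAtTwo`, U_T's own antecedent) and tree theorems.

WHAT (namespace `…Theorems.GenusExact.PlusDescent`; binders = U_T's rev-37 frame; only `hndiv` «`2^(M₀+1) ∤ P(1)`» of the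
`M₀`-clause is used, the infinite order of `y_K` is not even needed):
* §1 `exists_point_two_pow_smul_selmerGroup_mem_zmultiples_onHabitat` — there is `Q₀ ∈ E(K)` with, for EVERY level `M ≥ 1`,
  **`2^(M₀+2) • Sel_(2^M)(E/K) ⊆ ℤ · δ_M Q₀`** (gk2-p4 g21 proved this inclusion INSIDE `mordellWeilRank_baseChange_le_one_onHabitat` at the
  single level `M = 2M₀ + 5`; the proof is his, verbatim, with the level freed — laws (A)/(B) of `…RTRankDescentLaws`, (NPh) from the
  multiplicative prime, the algebra `zsmul_mem_zmultiples_of_exponent_laws`).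
* §2 `two_pow_smul_eq_zero_of_mem_sha_onHabitat` — **`2^(M₀+2) • a = 0` for every `a ∈ Ш(E/K)` of `2`-power order** (Kummer sequence:
  `exists_selmer_lift`, `torsionH1ToH1_kummerMapTorsion`).
* §3 `two_pow_smul_primaryComponent_sha_eq_zero_onHabitat` (the `hk` form), `primaryComponent_sha_two_eq_torsionBy_onHabitat`
  (`Ш(E/K)[2^∞] = Ш(E/K)[2^(M₀+2)]`), **`finite_primaryComponent_sha_two_onHabitat`** (`finite_sha_torsionBy_holds`, AEC X.4.2(b)),
  `natCard_primaryComponent_sha_two_pos_onHabitat`.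
* §4 `exists_natCard_primaryComponent_sha_two_eq_pow_two_mul_onHabitat` — **`#Ш(E/K)[2^∞] = 2^(2t)` for some `t`** (finite `2`-group +
  Cassels–Tate squareness `CasselsTateNumberField.isSquare_natCard_primaryComponent_sha`, unconditional in the tree); so on U_T's frame
  Q3R_T reads `t = M₀`, L_T (closed, p744020) is `M₀ ≤ t`, and U_T is the single inequality `t ≤ M₀`.

References: [Kolyvagin1990] Thm. A; [GrossLMS1991] §1 Thm. 1.3, §2 Thm. 2.2 (2), §10; [McCallumLMS1991] §1 Theorem, §5 (proof of Thm. 5.4,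
p. 288: `p^{M₀}` annihilates `Ш(E/K)_{p^∞}`); [SilvermanAEC2009] Thm. X.4.2, Thm. X.4.14; [MilneADT2006] Ch. I §6 (6.14), Prop. 6.9.
-/

set_option autoImplicit false
-- the Theorems namespace of this sub repeats the summit name by design (D-0017 nested layout)
set_option linter.dupNamespace false

noncomputable section

open scoped Classical
open scoped AddSubgroup

namespace Summit.BirchSwinnertonDyer.BirchSwinnertonDyer.Theorems.GenusExact.PlusDescent

open WeierstrassCurve NumberField IsDedekindDomain Field Literature.NumberTheory.EllipticCurves
  Literature.NumberTheory.GaloisRepresentations Literature.NumberTheory.EllipticCurves.ModularForms AddSubgroup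
open Summit.BirchSwinnertonDyer.BirchSwinnertonDyer.Theses.GenusKolyvaginAtTwo (KolyvaginRelationAtTwo)
open Summit.BirchSwinnertonDyer.Rank1Residual

/-! ## §1 `2^(M₀+2) • Sel_(2^M)(E/K) ⊆ ℤ · δ_M Q₀` at every level `M` -/

/-- **Kolyvagin's cyclic Selmer bound AT `2`, every level.**  On U_T's frame (non-CM, odd Tamagawa product, an odd multiplicative prime,
`Δ < 0`, `ρ_{E,2^n}` onto for all `n ≥ 1`; `K` imaginary quadratic, `d_K` odd `≠ −3`, Heegner, `K ≠ ℚ(√Δ), ℚ(√−2|Δ|)`; a frame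
`(Dt, β, ι)`, a conductor-`1` datum `d₁` with `2^(M₀+1) ∤ P(1)`; Q2 by name) there is a point `Q₀ ∈ E(K)` such that for EVERY `M ≥ 1`
and every Selmer class `s ∈ Sel_(2^M)(E/K)`: `2^(M₀+2) • s ∈ ℤ · δ_M Q₀` (`δ_M` the Kummer map modulo `2^M`).  `Q₀` is the `2`-indivisible
root of a `K`-rational Heegner point `Ph ↦ P(1)` (`2^{n₀} Q₀ = Ph`, `n₀ ≤ M₀` maximal).  Proof = gk2-p4 g21's
`mordellWeilRank_baseChange_le_one_onHabitat` with the level freed: laws (A)/(B) (`…RTRankDescentLaws`) bound the `±w(E)`-eigenclasses of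
`Sel_(2^M)` by `2^(M₀+1)`, (NPh_M) comes from the multiplicative prime, and `zsmul_mem_zmultiples_of_exponent_laws` assembles.
[cite: GrossLMS1991, §10 (Claims 10.1, 10.3)] [cite: Kolyvagin1990, Thm. A] [cite: McCallumLMS1991, §1 Theorem (Kolyvagin)] -/
theorem exists_point_two_pow_smul_selmerGroup_mem_zmultiples_onHabitat (hQ2 : KolyvaginRelationAtTwo)
    (W : WeierstrassCurve ℚ) [W.IsElliptic] [W.IsGloballyMinimal] [NeZero (W.conductorNorm ℤ)] (hcm : ¬ W.HasCM)
    (hT : Odd W.tamagawaProduct) (v : HeightOneSpectrum (𝓞 ℚ)) (h2v : ((2 : ℕ) : 𝓞 ℚ) ∉ v.asIdeal)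
    (hNv : ((W.conductorNorm ℤ : ℕ) : 𝓞 ℚ) ∈ v.asIdeal) (hmult : W.HasMultiplicativeReductionAt v) (hneg : W.Δ < 0)
    (K : Type) [Field K] [NumberField K] (hIQ : IsImaginaryQuadratic K) (hodd : Odd (NumberField.discr K))
    (h3 : NumberField.discr K ≠ -3) (hHe : SatisfiesHeegnerHypothesis (W.conductorNorm ℤ) K)
    (hsq1 : ¬ IsSquare ((NumberField.discr K : ℚ) * -|W.Δ|)) (hsq2 : ¬ IsSquare ((NumberField.discr K : ℚ) * (-(2 * |W.Δ|))))
    (hρ : ∀ n : ℕ, 0 < n → W.HasSurjectiveModNGaloisRep ((2 : ℤ) ^ n))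
    (Dt : ModularParametrizationData W (W.conductorNorm ℤ)) (β : ℤ) (ι : K →+* ℂ) (d₁ : KolyvaginHeegnerData Dt β ι 1) (M₀ : ℕ)
    (hndiv : ¬ ∃ Q : (W.baseChange (ringClassField K ι 1)).toAffine.Point, ((2 ^ (M₀ + 1) : ℕ) : ℤ) • Q = d₁.derivedPoint) :
    ∃ Q₀ : (W.baseChange K).toAffine.Point, ∀ (M : ℕ), 1 ≤ M →
      ∀ (hdiv : ∀ P : geomPoints (W.baseChange K), ∃ Q : geomPoints (W.baseChange K), ((2 ^ M : ℕ) : ℤ) • Q = P),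
      ∀ s ∈ selmerGroup (W.baseChange K) ((2 ^ M : ℕ) : ℤ),
        ((2 ^ (M₀ + 2) : ℕ) : ℤ) • s ∈ zmultiples (kummerMapTorsion (W.baseChange K) ((2 ^ M : ℕ) : ℤ) hdiv Q₀) := by
  -- adapted from gk2-p4 g21, `…RTRankDescentRankLeOne` (`mordellWeilRank_baseChange_le_one_onHabitat`), level `M` freed
  haveI : Fact (Nat.Prime 2) := ⟨Nat.prime_two⟩
  haveI : ∀ j : ℕ, NumberField (ringClassField K ι j) := JET.numberField_ringClassField K hIQ ι
  haveI hell : (W.baseChange K).IsElliptic := inferInstanceAs ((W.map (algebraMap ℚ K)).IsElliptic)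
  -- ### currencies
  have hsurN : ∀ m : ℕ, W.HasSurjectiveModNGaloisRep ((2 ^ m : ℕ) : ℤ) :=
    MinimalTwinBSDTwo.forall_hasSurjectiveModNGaloisRep_two_pow_of_pos W hρ
  have hρN : ∀ m : ℕ, W.HasSurjectiveModNGaloisRep (2 ^ m : ℕ) := fun m ↦ by exact_mod_cast hsurN m
  have hsurj1 : W.HasSurjectiveModNGaloisRep ((2 : ℤ) ^ 1) := hρ 1 one_pos
  have hs2 : W.HasSurjectiveModNGaloisRep 2 := by simpa using hsurj1
  have h2 : Module.finrank ℚ K = 2 := hIQ.1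
  have hN : (W.conductorNorm ℤ) ≠ 0 := NeZero.ne _
  obtain ⟨τ, hτ, hττ⟩ := Literature.NumberTheory.EllipticCurves.exists_conj_of_isImaginaryQuadratic (K := K) hIQ
  have hw : -W.rootNumber = 1 ∨ -W.rootNumber = -1 := by
    rcases W.rootNumber_eq_one_or with h | h <;> simp [h]
  -- ### no `2`-torsion in `E(K)`
  have h2tors : ∀ P : (W.baseChange K).toAffine.Point, (2 : ℤ) • P = 0 → P = 0 := fun P hP ↦
    EigenClassesFinite.forall_zsmul_two_pow_baseChange_eq_zero_of_hasSurjectiveModNGaloisRep_two W K h2 hs2 1 P (by simpa using hP)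
  -- ### the Heegner point `Ph ↦ P(1)` and `2^{M₀+1} ∤ Ph`
  obtain ⟨Ph, hPh, hPhmap⟩ := AdditiveKoly.exists_isHeegnerPoint_map_eq_derivedPoint_one (W := W) (K := K) (Dt := Dt) (β := β)
    (ι := ι) hIQ hHe d₁
  have hP₀ : ∀ Q : (W.baseChange K).toAffine.Point, ((2 ^ (M₀ + 1) : ℕ) : ℤ) • Q ≠ Ph :=
    forall_two_pow_smul_ne_bottom_of_not_dvd_derivedPoint d₁ Ph hPhmap le_rfl hndiv
  -- ### `Q₀ ∉ 2E(K)` with `2^{n₀} Q₀ = Ph`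
  obtain ⟨n₀, Q₀, hn₀, hQ₀, hQ₀2⟩ : ∃ (n₀ : ℕ) (Q₀ : (W.baseChange K).toAffine.Point), n₀ ≤ M₀ ∧ ((2 ^ n₀ : ℕ) : ℤ) • Q₀ = Ph ∧
      ∀ R : (W.baseChange K).toAffine.Point, (2 : ℤ) • R ≠ Q₀ := by
    let Pdiv : ℕ → Prop := fun n ↦ ∃ Q : (W.baseChange K).toAffine.Point, ((2 ^ n : ℕ) : ℤ) • Q = Ph
    have hP0 : Pdiv 0 := ⟨Ph, by rw [pow_zero, Nat.cast_one, one_zsmul]⟩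
    obtain ⟨Q₀, hQ₀⟩ : Pdiv (Nat.findGreatest Pdiv M₀) := Nat.findGreatest_spec (Nat.zero_le M₀) hP0
    refine ⟨Nat.findGreatest Pdiv M₀, Q₀, Nat.findGreatest_le M₀, hQ₀, fun R hR ↦ ?_⟩
    have hP : ((2 ^ (Nat.findGreatest Pdiv M₀ + 1) : ℕ) : ℤ) • R = Ph := by
      rw [pow_succ, Nat.cast_mul, mul_smul]
      have h2R : ((2 : ℕ) : ℤ) • R = Q₀ := by exact_mod_cast hR
      rw [h2R, hQ₀]
    by_cases hlt : Nat.findGreatest Pdiv M₀ + 1 ≤ M₀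
    · exact Nat.findGreatest_is_greatest (Nat.lt_succ_self _) hlt ⟨R, hP⟩
    · have heq : Nat.findGreatest Pdiv M₀ = M₀ := by have := Nat.findGreatest_le (P := Pdiv) M₀; omega
      rw [heq] at hP
      exact hP₀ R hP
  refine ⟨Q₀, fun M hM hdiv s hs ↦ ?_⟩
  -- ### the Kummer map `δ` modulo `2^M`
  set δ := kummerMapTorsion (W.baseChange K) ((2 ^ M : ℕ) : ℤ) hdiv with hδ
  have hker : δ.ker = (zsmulAddGroupHom (α := (W.baseChange K).toAffine.Point) ((2 ^ M : ℕ) : ℤ)).range :=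
    kummerMapTorsion_ker (W.baseChange K) ((2 ^ M : ℕ) : ℤ) hdiv
  have hker' : ∀ P : (W.baseChange K).toAffine.Point, δ P = 0 →
      ∃ R : (W.baseChange K).toAffine.Point, ((2 ^ M : ℕ) : ℤ) • R = P := fun P hP ↦ by
    have h : P ∈ δ.ker := (AddMonoidHom.mem_ker).mpr hP
    rw [hker] at h
    exact h
  have hδSel : ∀ P, δ P ∈ selmerGroup (W.baseChange K) ((2 ^ M : ℕ) : ℤ) := fun P ↦
    WeierstrassCurve.kummerMapTorsion_mem_selmerGroup (W.baseChange K) _ hdiv P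
  -- ### the class `y = c_M(1) = δ Ph`
  have hc1 : d₁.kolyvaginClass Nat.prime_two M = δ Ph :=
    VisiblePairAtTwo.kolyvaginClass_one_two_eq_kummerMapTorsion W K hIQ hodd hHe hsurj1 M d₁ Ph hPhmap
  set q := δ Q₀ with hqdef
  have hyq : δ Ph ∈ zmultiples q := by
    rw [← hQ₀, map_zsmul]
    exact zsmul_mem (mem_zmultiples q) _
  -- ### orders: `ord q = 2^M`, `ord y = 2^κ` with `M − M₀ ≤ κ`
  obtain ⟨mq, hmqM, hmq⟩ := exists_addOrderOf_galH1Torsion_eq_two_pow W K M q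
  have hmq_eq : mq = M := by
    by_contra hne
    have hlt : mq < M := lt_of_le_of_ne hmqM hne
    have h0 : ((2 ^ mq : ℕ) : ℤ) • q = 0 := (two_pow_zsmul_eq_zero_iff_of_addOrderOf W K hmq mq).mpr le_rfl
    obtain ⟨R, hR⟩ := hker' _ (by rw [map_zsmul]; exact h0)
    have hQ : Q₀ = ((2 ^ (M - mq) : ℕ) : ℤ) • R := eq_two_pow_zsmul_of_two_pow_zsmul_eq h2tors hmqM hR
    refine hQ₀2 (((2 ^ (M - mq - 1) : ℕ) : ℤ) • R) ?_
    rw [hQ, smul_smul]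
    congr 1
    push_cast
    rw [← pow_succ']
    congr 1
    omega
  rw [hmq_eq] at hmq
  obtain ⟨κ, hκM, hκ⟩ := exists_addOrderOf_galH1Torsion_eq_two_pow W K M (δ Ph)
  have hκge : M - M₀ ≤ κ := by
    by_contra hlt'
    have h0 : ((2 ^ κ : ℕ) : ℤ) • δ Ph = 0 := (two_pow_zsmul_eq_zero_iff_of_addOrderOf W K hκ κ).mpr le_rfl
    obtain ⟨R, hR⟩ := hker' _ (by rw [map_zsmul]; exact h0)
    have hPhR : Ph = ((2 ^ (M - κ) : ℕ) : ℤ) • R := eq_two_pow_zsmul_of_two_pow_zsmul_eq h2tors hκM hR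
    refine hP₀ (((2 ^ (M - κ - (M₀ + 1)) : ℕ) : ℤ) • R) ?_
    rw [hPhR, smul_smul]
    congr 1
    push_cast
    rw [← pow_add]
    congr 1
    omega
  -- ### the sign of `q`: `τ_* q = −w(E) • q` (Gross 5.3 transported to `Q₀`; odd torsion dies under `δ`)
  set τm := WeierstrassCurve.Affine.Point.map (W' := W) (τ : K →ₐ[ℚ] K) with hτm
  have hτq : conjAct W τ ((2 ^ M : ℕ) : ℤ) q = (-W.rootNumber) • q := by
    have hgross := X11b.KolyvaginBottom.isOfFinAddOrder_map_sub_neg_rootNumber_smul (W := W) hIQ hHe hPh τ hτ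
    have ht : IsOfFinAddOrder (τm Q₀ - (-W.rootNumber) • Q₀) := by
      refine isOfFinAddOrder_of_zsmul (n := ((2 ^ n₀ : ℕ) : ℤ)) (by positivity) ?_
      have heq : ((2 ^ n₀ : ℕ) : ℤ) • (τm Q₀ - (-W.rootNumber) • Q₀) = τm Ph - (-W.rootNumber) • Ph := by
        rw [smul_sub, ← map_zsmul, hQ₀, smul_comm, hQ₀]
      rw [heq]
      exact hgross
    obtain ⟨R, hR⟩ := exists_zsmul_two_pow_eq_of_odd_addOrderOf (W.baseChange K) M
      (odd_addOrderOf_of_forall_two_smul_eq_zero (W.baseChange K) h2tors ht)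
    have hδt : δ (τm Q₀ - (-W.rootNumber) • Q₀) = 0 := by
      have hmem : τm Q₀ - (-W.rootNumber) • Q₀ ∈ δ.ker := by
        rw [hker]
        exact ⟨R, hR⟩
      exact (AddMonoidHom.mem_ker).mp hmem
    rw [map_sub, map_zsmul, sub_eq_zero] at hδt
    rw [hqdef, conjAct_kummerMapTorsion W τ _ hdiv Q₀, ← hτm, hδt]
  -- ### (NPh_M) from the multiplicative prime
  have hNPh : ∀ z : galH1Torsion (W.baseChange K) ((2 ^ M : ℕ) : ℤ),
      (∀ ρ ∈ torsionFixing (W.baseChange K) ((2 ^ M : ℕ) : ℤ), h1Eval (W.baseChange K) ((2 ^ M : ℕ) : ℤ) z ρ = 0) →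
      (∀ w : HeightOneSpectrum (𝓞 K), z ∈ selmerLocalKer (W.baseChange K) (w.adicCompletion K) ((2 ^ M : ℕ) : ℤ)) → z = 0 :=
    fun z hz hzS ↦ NonPhantomPow.nonPhantomAtTwo_of_hasMultiplicativeReductionAt (W := W) (K := K) hT hρ hIQ hodd hsq1 hsq2 hN hHe
      h2v hNv hmult M hM z hz (fun w _ ↦ hzS w)
  -- ### the two laws, as `2^{M₀+1}`-annihilation
  have hbound : ∀ s : galH1Torsion (W.baseChange K) ((2 ^ M : ℕ) : ℤ),
      addOrderOf s * addOrderOf (d₁.kolyvaginClass Nat.prime_two M) ∣ 2 ^ (M + 1) → ((2 ^ (M₀ + 1) : ℕ) : ℤ) • s = 0 := by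
    intro s hs
    obtain ⟨a, -, ha⟩ := exists_addOrderOf_galH1Torsion_eq_two_pow W K M s
    rw [ha, hc1, hκ, ← pow_add, Nat.pow_dvd_pow_iff_le_right (by norm_num)] at hs
    exact (two_pow_zsmul_eq_zero_iff_of_addOrderOf W K ha (M₀ + 1)).mpr (by omega)
  have hB : ∀ s ∈ selmerGroup (W.baseChange K) ((2 ^ M : ℕ) : ℤ),
      conjAct W τ ((2 ^ M : ℕ) : ℤ) s = (-(-W.rootNumber)) • s → ((2 ^ (M₀ + 1) : ℕ) : ℤ) • s = 0 := by
    intro s hs hτs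
    rw [neg_neg] at hτs
    exact hbound s (addOrderOf_mul_addOrderOf_dvd_of_sign_rootNumber W K hQ2 hcm hρN hT hneg hIQ hodd h3 hHe hsq1 Dt β ι hM hτ hNPh d₁
      s hs hτs)
  have hA : ∀ s ∈ selmerGroup (W.baseChange K) ((2 ^ M : ℕ) : ℤ),
      conjAct W τ ((2 ^ M : ℕ) : ℤ) s = (-W.rootNumber) • s → Disjoint (zmultiples s) (zmultiples q) →
      ((2 ^ (M₀ + 1) : ℕ) : ℤ) • s = 0 := by
    intro s hs hτs hdisj
    refine hbound s (addOrderOf_mul_addOrderOf_dvd_of_sign_neg_rootNumber_of_disjoint W K hQ2 hcm hρN hT hneg hIQ hodd h3 hHe hsq1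
      Dt β ι hM hτ hNPh d₁ q (hδSel Q₀) hτq (by rw [hc1]; exact hyq) s hs hτs hdisj)
  -- ### the algebra: `2^{M₀+2} • Sel ⊆ ⟨q⟩`
  have hV : ∀ x : galH1Torsion (W.baseChange K) ((2 ^ M : ℕ) : ℤ), ((2 ^ M : ℕ) : ℤ) • x = 0 :=
    fun x ↦ zsmul_discreteH1_torsion ((2 ^ M : ℕ) : ℤ) x
  exact zsmul_mem_zmultiples_of_exponent_laws hV (conjAct W τ ((2 ^ M : ℕ) : ℤ))
    (fun x ↦ conjAct_conjAct_of_mul_self W hττ _ x) (selmerGroup (W.baseChange K) ((2 ^ M : ℕ) : ℤ))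
    (fun x hx ↦ conjAct_mem_selmerGroup W (fun w ↦ hIQ.2.isComplex w) τ _ hx) hw (hδSel Q₀) hmq hτq hB hA s hs

/-! ## §2 `2^(M₀+2)` kills every class of `Ш(E/K)` of `2`-power order -/

/-- **Kolyvagin's annihilation AT `2`: `2^(M₀+2) • Ш(E/K)[2^∞] = 0` on U_T's frame.**  For `a ∈ Ш(E/K)` with `2^j • a = 0`: with
`M = j + 1`, `a` lifts to `s ∈ Sel_(2^M)(E/K)` (Kummer sequence, `exists_selmer_lift`), `2^(M₀+2) • s ∈ ℤ · δ_M Q₀` (§1), and `δ_M Q₀` dies in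
`H¹(K, E)` (`torsionH1ToH1_kummerMapTorsion`); hence `2^(M₀+2) • a = 0`.
[cite: Kolyvagin1990, Thm. A] [cite: McCallumLMS1991, §1 Theorem and §5 (proof of Thm. 5.4, p. 288)] [cite: SilvermanAEC2009, Thm. X.4.2(a)] -/
theorem two_pow_smul_eq_zero_of_mem_sha_onHabitat (hQ2 : KolyvaginRelationAtTwo)
    (W : WeierstrassCurve ℚ) [W.IsElliptic] [W.IsGloballyMinimal] [NeZero (W.conductorNorm ℤ)] (hcm : ¬ W.HasCM)
    (hT : Odd W.tamagawaProduct) (v : HeightOneSpectrum (𝓞 ℚ)) (h2v : ((2 : ℕ) : 𝓞 ℚ) ∉ v.asIdeal)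
    (hNv : ((W.conductorNorm ℤ : ℕ) : 𝓞 ℚ) ∈ v.asIdeal) (hmult : W.HasMultiplicativeReductionAt v) (hneg : W.Δ < 0)
    (K : Type) [Field K] [NumberField K] (hIQ : IsImaginaryQuadratic K) (hodd : Odd (NumberField.discr K))
    (h3 : NumberField.discr K ≠ -3) (hHe : SatisfiesHeegnerHypothesis (W.conductorNorm ℤ) K)
    (hsq1 : ¬ IsSquare ((NumberField.discr K : ℚ) * -|W.Δ|)) (hsq2 : ¬ IsSquare ((NumberField.discr K : ℚ) * (-(2 * |W.Δ|))))
    (hρ : ∀ n : ℕ, 0 < n → W.HasSurjectiveModNGaloisRep ((2 : ℤ) ^ n))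
    (Dt : ModularParametrizationData W (W.conductorNorm ℤ)) (β : ℤ) (ι : K →+* ℂ) (d₁ : KolyvaginHeegnerData Dt β ι 1) (M₀ : ℕ)
    (hndiv : ¬ ∃ Q : (W.baseChange (ringClassField K ι 1)).toAffine.Point, ((2 ^ (M₀ + 1) : ℕ) : ℤ) • Q = d₁.derivedPoint)
    {a : (W.baseChange K).galH1} (ha : a ∈ (W.baseChange K).sha) {j : ℕ} (hja : ((2 ^ j : ℕ) : ℤ) • a = 0) :
    ((2 ^ (M₀ + 2) : ℕ) : ℤ) • a = 0 := by
  haveI hell : (W.baseChange K).IsElliptic := inferInstanceAs ((W.map (algebraMap ℚ K)).IsElliptic)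
  obtain ⟨Q₀, hQ₀⟩ := exists_point_two_pow_smul_selmerGroup_mem_zmultiples_onHabitat hQ2 W hcm hT v h2v hNv hmult hneg K hIQ hodd h3
    hHe hsq1 hsq2 hρ Dt β ι d₁ M₀ hndiv
  -- level `M = j + 1 ≥ 1`; `2^M • a = 0`
  set M := j + 1 with hMdef
  have hM : 1 ≤ M := by omega
  haveI : NeZero (2 ^ M) := ⟨pow_ne_zero _ two_ne_zero⟩
  have hMa : ((2 ^ M : ℕ) : ℤ) • a = 0 := by
    rw [hMdef, pow_succ, Nat.cast_mul, mul_comm, mul_smul, hja, zsmul_zero]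
  have hn : ((2 ^ M : ℕ) : ℤ) ≠ 0 := by positivity
  have hdiv : ∀ P : geomPoints (W.baseChange K), ∃ Q : geomPoints (W.baseChange K), ((2 ^ M : ℕ) : ℤ) • Q = P :=
    (W.baseChange K).zsmul_geomPoints_surjective_of_charZero hn
  -- Selmer lift and the cyclic bound
  obtain ⟨s, hs, hsa⟩ := exists_selmer_lift (W := W.baseChange K) (m := 2 ^ M) ha hMa
  obtain ⟨k, hk⟩ := (mem_zmultiples_iff).mp (hQ₀ M hM hdiv s hs)
  -- apply `H¹(K, E[2^M]) → H¹(K, E)`: `δ_M Q₀ ↦ 0`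
  have h0 : torsionH1ToH1 (W.baseChange K) ((2 ^ M : ℕ) : ℤ) (kummerMapTorsion (W.baseChange K) ((2 ^ M : ℕ) : ℤ) hdiv Q₀) = 0 :=
    torsionH1ToH1_kummerMapTorsion (W.baseChange K) _ hdiv Q₀
  rw [← hsa, ← map_zsmul, ← hk, map_zsmul, h0, zsmul_zero]

/-! ## §3 Finiteness of `Ш(E/K)[2^∞]` -/

/-- **The `hk` form: `2^(M₀+2) • x = 0` for every `x ∈ Ш(E/K)[2^∞]`** (`AddCommGroup.primaryComponent`: the classes of `Ш(E/K)` killed by a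
power of `2`) — the hypothesis of the tree's `exists_primaryComponent_ctLevelPairing` / `exists_selmerToPrimaryComponent` /
`sha_hL_of_pow_kills` at `p = 2`, `k = M₀ + 2`, on U_T's frame. [cite: Kolyvagin1990, Thm. A] [cite: McCallumLMS1991, §5 (proof of Thm. 5.4, p. 288)] -/
theorem two_pow_smul_primaryComponent_sha_eq_zero_onHabitat (hQ2 : KolyvaginRelationAtTwo)
    (W : WeierstrassCurve ℚ) [W.IsElliptic] [W.IsGloballyMinimal] [NeZero (W.conductorNorm ℤ)] (hcm : ¬ W.HasCM)
    (hT : Odd W.tamagawaProduct) (v : HeightOneSpectrum (𝓞 ℚ)) (h2v : ((2 : ℕ) : 𝓞 ℚ) ∉ v.asIdeal)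
    (hNv : ((W.conductorNorm ℤ : ℕ) : 𝓞 ℚ) ∈ v.asIdeal) (hmult : W.HasMultiplicativeReductionAt v) (hneg : W.Δ < 0)
    (K : Type) [Field K] [NumberField K] (hIQ : IsImaginaryQuadratic K) (hodd : Odd (NumberField.discr K))
    (h3 : NumberField.discr K ≠ -3) (hHe : SatisfiesHeegnerHypothesis (W.conductorNorm ℤ) K)
    (hsq1 : ¬ IsSquare ((NumberField.discr K : ℚ) * -|W.Δ|)) (hsq2 : ¬ IsSquare ((NumberField.discr K : ℚ) * (-(2 * |W.Δ|))))
    (hρ : ∀ n : ℕ, 0 < n → W.HasSurjectiveModNGaloisRep ((2 : ℤ) ^ n))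
    (Dt : ModularParametrizationData W (W.conductorNorm ℤ)) (β : ℤ) (ι : K →+* ℂ) (d₁ : KolyvaginHeegnerData Dt β ι 1) (M₀ : ℕ)
    (hndiv : ¬ ∃ Q : (W.baseChange (ringClassField K ι 1)).toAffine.Point, ((2 ^ (M₀ + 1) : ℕ) : ℤ) • Q = d₁.derivedPoint) :
    ∀ x ∈ AddCommGroup.primaryComponent (W.baseChange K).sha 2, 2 ^ (M₀ + 2) • x = 0 := by
  intro x hx
  obtain ⟨j, hj⟩ := (AddCommGroup.mem_primaryComponent).1 hx
  have hja : ((2 ^ j : ℕ) : ℤ) • (x : (W.baseChange K).galH1) = 0 := by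
    rw [natCast_zsmul, ← AddSubgroupClass.coe_nsmul, hj, ZeroMemClass.coe_zero]
  have h := two_pow_smul_eq_zero_of_mem_sha_onHabitat hQ2 W hcm hT v h2v hNv hmult hneg K hIQ hodd h3 hHe hsq1 hsq2 hρ Dt β ι d₁ M₀
    hndiv x.2 hja
  rw [natCast_zsmul, ← AddSubgroupClass.coe_nsmul] at h
  exact_mod_cast h

/-- **`Ш(E/K)[2^∞] = Ш(E/K)[2^(M₀+2)]`** as subgroups of `Ш(E/K)`, on U_T's frame. [cite: Kolyvagin1990, Thm. A]
[cite: McCallumLMS1991, §5 (proof of Thm. 5.4, p. 288)] -/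
theorem primaryComponent_sha_two_eq_torsionBy_onHabitat (hQ2 : KolyvaginRelationAtTwo)
    (W : WeierstrassCurve ℚ) [W.IsElliptic] [W.IsGloballyMinimal] [NeZero (W.conductorNorm ℤ)] (hcm : ¬ W.HasCM)
    (hT : Odd W.tamagawaProduct) (v : HeightOneSpectrum (𝓞 ℚ)) (h2v : ((2 : ℕ) : 𝓞 ℚ) ∉ v.asIdeal)
    (hNv : ((W.conductorNorm ℤ : ℕ) : 𝓞 ℚ) ∈ v.asIdeal) (hmult : W.HasMultiplicativeReductionAt v) (hneg : W.Δ < 0)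
    (K : Type) [Field K] [NumberField K] (hIQ : IsImaginaryQuadratic K) (hodd : Odd (NumberField.discr K))
    (h3 : NumberField.discr K ≠ -3) (hHe : SatisfiesHeegnerHypothesis (W.conductorNorm ℤ) K)
    (hsq1 : ¬ IsSquare ((NumberField.discr K : ℚ) * -|W.Δ|)) (hsq2 : ¬ IsSquare ((NumberField.discr K : ℚ) * (-(2 * |W.Δ|))))
    (hρ : ∀ n : ℕ, 0 < n → W.HasSurjectiveModNGaloisRep ((2 : ℤ) ^ n))
    (Dt : ModularParametrizationData W (W.conductorNorm ℤ)) (β : ℤ) (ι : K →+* ℂ) (d₁ : KolyvaginHeegnerData Dt β ι 1) (M₀ : ℕ)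
    (hndiv : ¬ ∃ Q : (W.baseChange (ringClassField K ι 1)).toAffine.Point, ((2 ^ (M₀ + 1) : ℕ) : ℤ) • Q = d₁.derivedPoint) :
    AddCommGroup.primaryComponent (W.baseChange K).sha 2 = ((W.baseChange K).sha)[(2 ^ (M₀ + 2) : ℕ)] :=
  primaryComponent_eq_torsionBy
    (two_pow_smul_primaryComponent_sha_eq_zero_onHabitat hQ2 W hcm hT v h2v hNv hmult hneg K hIQ hodd h3 hHe hsq1 hsq2 hρ Dt β ι d₁ M₀
      hndiv)

/-- **`Ш(E/K)[2^∞]` IS FINITE on U_T's frame** (Kolyvagin's Theorem A, Ш-part, AT `2`, from Q2 and the tree): `Ш(E/K)[2^∞] = Ш(E/K)[2^(M₀+2)]`,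
and `Ш(E/K)[n]` is finite for every `n ≠ 0` (weak Mordell–Weil / Kummer sequence, `finite_sha_torsionBy_holds`).
[cite: Kolyvagin1990, Thm. A] [cite: GrossLMS1991, §1 Thm. 1.3 (2)] [cite: SilvermanAEC2009, Thm. X.4.2(b)] -/
theorem finite_primaryComponent_sha_two_onHabitat (hQ2 : KolyvaginRelationAtTwo)
    (W : WeierstrassCurve ℚ) [W.IsElliptic] [W.IsGloballyMinimal] [NeZero (W.conductorNorm ℤ)] (hcm : ¬ W.HasCM)
    (hT : Odd W.tamagawaProduct) (v : HeightOneSpectrum (𝓞 ℚ)) (h2v : ((2 : ℕ) : 𝓞 ℚ) ∉ v.asIdeal)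
    (hNv : ((W.conductorNorm ℤ : ℕ) : 𝓞 ℚ) ∈ v.asIdeal) (hmult : W.HasMultiplicativeReductionAt v) (hneg : W.Δ < 0)
    (K : Type) [Field K] [NumberField K] (hIQ : IsImaginaryQuadratic K) (hodd : Odd (NumberField.discr K))
    (h3 : NumberField.discr K ≠ -3) (hHe : SatisfiesHeegnerHypothesis (W.conductorNorm ℤ) K)
    (hsq1 : ¬ IsSquare ((NumberField.discr K : ℚ) * -|W.Δ|)) (hsq2 : ¬ IsSquare ((NumberField.discr K : ℚ) * (-(2 * |W.Δ|))))
    (hρ : ∀ n : ℕ, 0 < n → W.HasSurjectiveModNGaloisRep ((2 : ℤ) ^ n))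
    (Dt : ModularParametrizationData W (W.conductorNorm ℤ)) (β : ℤ) (ι : K →+* ℂ) (d₁ : KolyvaginHeegnerData Dt β ι 1) (M₀ : ℕ)
    (hndiv : ¬ ∃ Q : (W.baseChange (ringClassField K ι 1)).toAffine.Point, ((2 ^ (M₀ + 1) : ℕ) : ℤ) • Q = d₁.derivedPoint) :
    Finite (AddCommGroup.primaryComponent (W.baseChange K).sha 2) := by
  haveI hell : (W.baseChange K).IsElliptic := inferInstanceAs ((W.map (algebraMap ℚ K)).IsElliptic)
  rw [primaryComponent_sha_two_eq_torsionBy_onHabitat hQ2 W hcm hT v h2v hNv hmult hneg K hIQ hodd h3 hHe hsq1 hsq2 hρ Dt β ι d₁ M₀ hndiv]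
  exact (W.baseChange K).finite_sha_torsionBy_holds ((2 ^ (M₀ + 2) : ℕ) : ℤ) (by positivity)

/-- **`#Ш(E/K)[2^∞] > 0` on U_T's frame** (no junk value: the group is finite). [cite: Kolyvagin1990, Thm. A] -/
theorem natCard_primaryComponent_sha_two_pos_onHabitat (hQ2 : KolyvaginRelationAtTwo)
    (W : WeierstrassCurve ℚ) [W.IsElliptic] [W.IsGloballyMinimal] [NeZero (W.conductorNorm ℤ)] (hcm : ¬ W.HasCM)
    (hT : Odd W.tamagawaProduct) (v : HeightOneSpectrum (𝓞 ℚ)) (h2v : ((2 : ℕ) : 𝓞 ℚ) ∉ v.asIdeal)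
    (hNv : ((W.conductorNorm ℤ : ℕ) : 𝓞 ℚ) ∈ v.asIdeal) (hmult : W.HasMultiplicativeReductionAt v) (hneg : W.Δ < 0)
    (K : Type) [Field K] [NumberField K] (hIQ : IsImaginaryQuadratic K) (hodd : Odd (NumberField.discr K))
    (h3 : NumberField.discr K ≠ -3) (hHe : SatisfiesHeegnerHypothesis (W.conductorNorm ℤ) K)
    (hsq1 : ¬ IsSquare ((NumberField.discr K : ℚ) * -|W.Δ|)) (hsq2 : ¬ IsSquare ((NumberField.discr K : ℚ) * (-(2 * |W.Δ|))))
    (hρ : ∀ n : ℕ, 0 < n → W.HasSurjectiveModNGaloisRep ((2 : ℤ) ^ n))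
    (Dt : ModularParametrizationData W (W.conductorNorm ℤ)) (β : ℤ) (ι : K →+* ℂ) (d₁ : KolyvaginHeegnerData Dt β ι 1) (M₀ : ℕ)
    (hndiv : ¬ ∃ Q : (W.baseChange (ringClassField K ι 1)).toAffine.Point, ((2 ^ (M₀ + 1) : ℕ) : ℤ) • Q = d₁.derivedPoint) :
    0 < Nat.card (AddCommGroup.primaryComponent (W.baseChange K).sha 2) := by
  haveI := finite_primaryComponent_sha_two_onHabitat hQ2 W hcm hT v h2v hNv hmult hneg K hIQ hodd h3 hHe hsq1 hsq2 hρ Dt β ι d₁ M₀ hndiv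
  exact Nat.card_pos

/-! ## §4 `#Ш(E/K)[2^∞] = 2^(2t)` -/

/-- A finite additive `p`-primary component has `p`-power order (it is a `p`-group; Mathlib `IsPGroup.iff_card` via `Multiplicative`). [folklore] -/
theorem exists_natCard_addPrimaryComponent_eq_pow {A : Type*} [AddCommGroup A] (p : ℕ) [Fact p.Prime]
    [Finite (AddCommGroup.primaryComponent A p)] : ∃ k : ℕ, Nat.card (AddCommGroup.primaryComponent A p) = p ^ k := by
  have hP : IsPGroup p (Multiplicative (AddCommGroup.primaryComponent A p)) := by
    intro g
    obtain ⟨k, hk⟩ := (AddCommGroup.mem_primaryComponent).1 (Multiplicative.toAdd g).2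
    refine ⟨k, Multiplicative.toAdd.injective ?_⟩
    rw [toAdd_pow, toAdd_one]
    exact Subtype.ext (by simpa using hk)
  obtain ⟨k, hk⟩ := IsPGroup.iff_card.1 hP
  exact ⟨k, hk⟩

/-- **`#Ш(E/K)[2^∞] = 2^(2t)` on U_T's frame**: finite (§3) of `2`-power order, and a square by Cassels–Tate
(`CasselsTateNumberField.isSquare_natCard_primaryComponent_sha`, unconditional in the tree).  On this frame Q3R_T reads `t = M₀`; its lower half
L_T `2^(2M₀) ∣ #Ш(E/K)[2^∞]` (closed, `powDvdShaCardAtTwoRT_proof`) is `M₀ ≤ t`, and U_T is the single inequality `t ≤ M₀`.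
[cite: Kolyvagin1990, Thm. A] [cite: SilvermanAEC2009, Thm. X.4.14] [cite: McCallumLMS1991, §1 Theorem] -/
theorem exists_natCard_primaryComponent_sha_two_eq_pow_two_mul_onHabitat (hQ2 : KolyvaginRelationAtTwo)
    (W : WeierstrassCurve ℚ) [W.IsElliptic] [W.IsGloballyMinimal] [NeZero (W.conductorNorm ℤ)] (hcm : ¬ W.HasCM)
    (hT : Odd W.tamagawaProduct) (v : HeightOneSpectrum (𝓞 ℚ)) (h2v : ((2 : ℕ) : 𝓞 ℚ) ∉ v.asIdeal)
    (hNv : ((W.conductorNorm ℤ : ℕ) : 𝓞 ℚ) ∈ v.asIdeal) (hmult : W.HasMultiplicativeReductionAt v) (hneg : W.Δ < 0)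
    (K : Type) [Field K] [NumberField K] (hIQ : IsImaginaryQuadratic K) (hodd : Odd (NumberField.discr K))
    (h3 : NumberField.discr K ≠ -3) (hHe : SatisfiesHeegnerHypothesis (W.conductorNorm ℤ) K)
    (hsq1 : ¬ IsSquare ((NumberField.discr K : ℚ) * -|W.Δ|)) (hsq2 : ¬ IsSquare ((NumberField.discr K : ℚ) * (-(2 * |W.Δ|))))
    (hρ : ∀ n : ℕ, 0 < n → W.HasSurjectiveModNGaloisRep ((2 : ℤ) ^ n))
    (Dt : ModularParametrizationData W (W.conductorNorm ℤ)) (β : ℤ) (ι : K →+* ℂ) (d₁ : KolyvaginHeegnerData Dt β ι 1) (M₀ : ℕ)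
    (hndiv : ¬ ∃ Q : (W.baseChange (ringClassField K ι 1)).toAffine.Point, ((2 ^ (M₀ + 1) : ℕ) : ℤ) • Q = d₁.derivedPoint) :
    ∃ t : ℕ, Nat.card (AddCommGroup.primaryComponent (W.baseChange K).sha 2) = 2 ^ (2 * t) := by
  haveI : Fact (Nat.Prime 2) := ⟨Nat.prime_two⟩
  haveI hell : (W.baseChange K).IsElliptic := inferInstanceAs ((W.map (algebraMap ℚ K)).IsElliptic)
  haveI := finite_primaryComponent_sha_two_onHabitat hQ2 W hcm hT v h2v hNv hmult hneg K hIQ hodd h3 hHe hsq1 hsq2 hρ Dt β ι d₁ M₀ hndiv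
  obtain ⟨k, hk⟩ := exists_natCard_addPrimaryComponent_eq_pow (A := (W.baseChange K).sha) 2
  obtain ⟨r, hr⟩ := CasselsTateNumberField.isSquare_natCard_primaryComponent_sha (W.baseChange K) 2
  -- `r * r = 2^k` forces `r = 2^t`, `k = 2t`
  have hr2 : r * r = 2 ^ k := by rw [← hr, hk]
  have hrdvd : r ∣ 2 ^ k := ⟨r, hr2.symm⟩
  obtain ⟨t, -, rfl⟩ := (Nat.dvd_prime_pow Nat.prime_two).mp hrdvd
  refine ⟨t, ?_⟩
  rw [hr, ← pow_add, two_mul]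

end Summit.BirchSwinnertonDyer.BirchSwinnertonDyer.Theorems.GenusExact.PlusDescent

end
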